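import Summits.QuantumFields.YangMills.Theorems.BalabanUVNodesN12SliceDatumCurvatureOfClass
import Literature.MathematicalPhysics.QuantumFieldTheory.Balaban1983to89.Node00.MultiScaleFibreChartB
import Literature.MathematicalPhysics.QuantumFieldTheory.Balaban1983to89.B15Prop1SliceDatumCurvatureUniformB
import HarnessLib

/-!
# DAG node N12 [B15] — THE CHART-CURVATURE LETTER (R2) OF THE (β)-SPLIT's MULTIPLIER ROW, INHABITED PER HEIGHT FOR EVERY CONFIGURATION OF NODE 00's (2.12) CLASS: — **BOND-DATUM EDITION** (`…N12SliceDatumCurvatureOfClassB`, USED DECLARATIONS ONLY)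

The print-datum ([Balaban1984PropagatorsII] (2.3)) (γ) twin of `Summits/…/Theorems/BalabanUVNodesN12SliceDatumCurvatureOfClass.lean`: the declarations of the parent whose STATEMENT reads the determining datum
(`exists_uniform_sliceDatum_curvatureLetter_of_class`) and which N12's junction of record v14ᴸ uses (dag-n12-c g35 probe-2 census `UsedConstsN12RoadTyped2`, THEOREMS block), re-typed over a
BOND-LEVEL datum `𝔅 : BDetSet` (F0a `B15DeterminingSetsB`) and dag-n12-c's bond-datum chart `Node00.msChartB` (✓p774329; `msChart 𝐁 = msChartB (bondsDet 𝐁)` by `rfl`).  GENERATOR twin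
(this seat's `work/g32/gen_thm.py`, block-extracted from the parent's tree bytes): namespace `…N12SliceDatumCurvatureOfClassB`, SAME short names, `DetSet ↦ BDetSet`, `AgreeOn 𝐁 ↦ AgreeOnB 𝔅`,
`IsMinimizer ↦ IsMinimizerB`, `bondsOf (𝐁 j) ↦ 𝔅 j`, `msChart ∕ constrCard ∕ constrEnum ∕ ConstrSet ↦ …B`, NODE 00 chart lemmas `…msChart… ↦ …msChartB…`; proofs VERBATIM; the parent's
datum-free declarations REUSED BY NAME (`open`), never copied (private plumbing excepted, №366 R2).  The parent's (b) statements are the instances `𝔅 := bondsDet 𝐁`.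

Cell `pub-ymgap` (HUMAN RULINGS D-0062 ∕ D-0149), seat `pub-ymgap-dag-n12-d` g32 (R134 N12 [B15] s2; the (ii) Theorems-side re-key of N12's road at print's [II] (2.3) datum — director-ym №338 ∕
№343 (E1)(iii-b), FLAG №16 ∕ ruling (α); dag-n12-c DESIGN memo a793b2ebc0b803bf (ii); `N12-ROAD-TWIN-ORDER-2026-08-30.md`).  Count-neutral helper of K1⁹ `stmt-QuantumFields-27364`,
`--kind proof --supports … --as helper`.  THEOREMS ONLY (0 `def`, 0 `instance`, 0 `sorry`).

HONEST FRAMING (director-ym №338 (5)).  PURELY ADDITIVE: the parent stays landed and true on its own text; nothing in it is edited; no displayed premise of any consumer is deleted or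
weakened; every hypothesis of the parent stays a hypothesis.  Nothing of Bałaban's analysis asserted; N12 NOT discharged; K0⁷ ∕ K1⁹ NOT closed; counts unmoved (typed 28∕28 · discharged
8∕27, A 8∕28; K 1∕4); one finite 𝕋⁴ programme at fixed ε — R4 closes the conditional rung `BalabanLadder.UV` only; NOT the Yang–Mills mass gap (Clay); nothing continuum ∕ ℝ⁴ ∕ OS.

PARENT's DOCSTRING (the mathematics and the citations; read the site-level `𝐁` as the bond datum `𝔅`):
# DAG node N12 [B15] — THE CHART-CURVATURE LETTER (R2) OF THE (β)-SPLIT's MULTIPLIER ROW, INHABITED PER HEIGHT FOR EVERY CONFIGURATION OF NODE 00's (2.12) CLASS: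
# one `M₂ ≥ 0` per (instance, height) with `‖D²Φ₀(0)[p̂,p̂]‖ ≤ M₂·Σ_b‖p b‖²` for every `U₀ ∈ U_k({Ω_j(Z)}, εreg)`, every datum on its fibre, every slice

[Balaban1985Variational] = «[15]», (2) p. 278, Sect. C (44)–(48) p. 285, (81)–(83) p. 290, Prop. 9 (190) p. 309; [Balaban1989LargeFieldII] = «[LF-II]», (1.12)–(1.13) p. 359;
[Balaban1988Convergent] = «[III]», (2.2) p. 255, (2.10)–(2.13) pp. 256–257; [Balaban1987RG1] (0.4) p. 253.

Cell `pub-ymgap`, HUMAN RULINGS D-0062 ∕ D-0149, lane owner `pub-ymgap-dag-n12-c` (g26, strategy s1).  Key K1⁹ `stmt-QuantumFields-27364`, `--kind proof --supports … --as helper`; count-neutral.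
NEW leaf; CONSUMED BY NAME, nothing modified: the lane's `B15Prop1SliceDatumCurvatureUniform.exists_uniform_sliceDatum_curvatureLetter` (g26: one constant on a compact guarded family),
`N12TowerGuardsOfClass.guardOn_towerRegion_of_plaqSmallOn_towerBox` (g24: plaquette-small on the tower box ⇒ guarded along the tower), dag-n12-w3's `boxPlaqs_subset_plaqsOf_topSeq_pred`
(the tower box lies in the class region one level down), ρ5b's `boxSide_mul_eta_sq_le`.

WHY.  dag-n12-w6's (M)-row producer `…N12MultiplierLetterOfClass` (INTENT-4, 2026-08-29) displays per base field ONE analytic letter, (R2) `hcurv`, whose constant `M₂` enters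
`m := 8(d−1)·δ·B₁·M₂` — chosen BEFORE the base field in the (J0′) producer (p712371 ∕ V2 p717767 ∕ V3), hence needed UNIFORMLY per height.  THIS FILE supplies it: the set
`T = {U | every plaquette of the tower box of every positive-level constrained bond (j, c) of 𝐁_k(Z) is ≤ ρ″∕(2(d−1)(6Lʲ−4))-small}` is CLOSED in the compact `SU(2)^{bonds}`, contains the class
([15] (2) at tolerance `εreg·η_{j−1}²` on the box, which lies in `Ω_{j−1}`'s plaquettes; the floor `12(d−1)L·εreg ≤ ρ″`), and every `U ∈ T` is (0.4)-guarded along every tower (strict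
tolerance `ρ″∕((d−1)(6Lʲ−4))`, budget exactly `ρ″`); the Literature file gives one `M₂` on `T`.

CONTENTS (namespace `Summit.QuantumFields.YangMills.BalabanUVNodes.N12SliceDatumCurvatureOfClass`; theorems only — two private continuity lemmas and ONE public theorem; no `def`, no
`instance`, no `sorry`).  ★★★ `exists_uniform_sliceDatum_curvatureLetter_of_class`.

HONEST FRAMING ∕ LOCATED.  Compactness + bookkeeping by name; `M₂` is an EXISTENCE constant per (instance, height) (U4 grade; print's volume-uniform `O(1)` of [15] (46) NOT claimed);
nothing of Bałaban's estimates asserted; count-neutral helper; N12 NOT discharged; K1⁹ NOT closed; counts unmoved; one finite 𝕋⁴ programme at fixed ε — R4 closes the conditional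
finite-𝕋⁴ rung `BalabanLadder.UV` only; NOT continuum ∕ OS ∕ mass gap ∕ Clay.
-/

noncomputable section

open scoped BigOperators Matrix.Norms.L2Operator Topology

namespace Summit.QuantumFields.YangMills.BalabanUVNodes.N12SliceDatumCurvatureOfClassB

open Literature.MathematicalPhysics.QuantumFieldTheory.Balaban1983to89.B15DeterminingSetsB

open Set Metric Filter
open Literature.MathematicalPhysics.QuantumFieldTheory.Balaban1983to89
open Literature.MathematicalPhysics.QuantumFieldTheory.Balaban1983to89.Node00 (SU coeField SmallBelow ConstrSetB constrCardB constrEnumB avOfRecord regMSCoPOfRecord suppDomOfRecord topSeq Stage7Numerics)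
open T4Continuum B15DeterminingSets GaugeField
open B14.Eq213MaximalDomains (side)
open B14.Eq213DetSet (Bj Bj_mid Bj_top maxDomT)
open B14.Eq22Determines (blockIter)
open B10Eq42TorusConstraint (bondsIn)
open B15AveragingHolomorphic (iterMh)
open B15SU2ChartHolomorphic (expMulC logCoordC)
open B15Prop1AnalyticExtClause (cplxVec)
open B15Prop1ChartCalculusSU2 (E3)
open ExpMeanLog (expMeanLogSU)
open BlockAveraging (Small blockAvg)
open T4CubeChartGnomonic (SU2)
open T4AxialGaugeSmallField (boxPlaqs)
open T4ReflectionCone (three_le_L)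
open B15Prop1SliceDatumCurvatureUniformB (exists_uniform_sliceDatum_curvatureLetter)
open Summit.QuantumFields.YangMills.BalabanUVNodes.N12TowerGuardsOfClass (guardOn_towerRegion_of_plaqSmallOn_towerBox)
open Summit.QuantumFields.YangMills.BalabanUVNodes.N12TowerProxiesOfClass (boxSide_mul_eta_sq_le)
open Summit.QuantumFields.YangMills.BalabanUVNodes.N12WindowNearRegionGeometry (boxPlaqs_subset_plaqsOf_topSeq_pred exists_word_endpoints)

section
variable {F : T4Family}

/-- Plaquette variables are continuous in the configuration (finite products and inverses in `SU(2)`). [cite: Balaban1985Averaging, (9) p.19 (bookkeeping)] -/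
private theorem continuous_plaqHol {P : Params} (q : Plaq P 0) : Continuous fun U : GaugeField P 0 SU2 => GaugeField.plaqHol U q := by
  have hb : ∀ b : PBond P 0, Continuous fun U : GaugeField P 0 SU2 => U b := fun b => continuous_apply b
  unfold GaugeField.plaqHol
  exact (((hb _).mul (hb _)).mul (hb _).inv).mul (hb _).inv

end

section
variable {F : T4Family}

/-- The plaquette letter `U ↦ |U(∂q) − 1|` is continuous. [cite: Balaban1985Variational, (2) p.278 (bookkeeping)] -/
private theorem continuous_dist1_plaqHol {P : Params} (q : Plaq P 0) : Continuous fun U : GaugeField P 0 SU2 => dist1 (GaugeField.plaqHol U q) := by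
  have h : Continuous fun U : GaugeField P 0 SU2 => ‖((GaugeField.plaqHol U q : SU2) : Matrix (Fin 2) (Fin 2) ℂ) - 1‖ :=
    ((continuous_subtype_val.comp (continuous_plaqHol q)).sub continuous_const).norm
  exact h

end

section
variable {F : T4Family}

/-- ★★★ **THE CHART-CURVATURE LETTER (R2) OF THE (M)-ROW PRODUCER, INHABITED PER HEIGHT FOR EVERY (2.12)-CLASS CONFIGURATION.**  Once per instance `(Kt, k, Z, ν)` and height: the
standing rows `2 ≤ d`, `k + 1 ≤ m + K`, `4L ≤ M₁`, the cube divisibility, `0 ≤ εreg`, the radius letter `hsbU` at a POSITIVE radius `ρ″` and the floor `12(d−1)L·εreg ≤ ρ″` (twice the capstone's).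
CONCLUSION: ONE `M₂ ≥ 0` such that for EVERY `U₀ ∈ U_k({Ω_j(Z)}, εreg)` (no minimality needed), EVERY multi-scale datum `W` on whose fibre `U₀` lies, EVERY complex slice `S` and the slice
datum coordinates `Φ₀` by their formula, and every real slice field `p` (kernel hypothesis carried, unused): `‖D²Φ₀(0)[p̂,p̂]‖ ≤ M₂·Σ_b‖p b‖²` — dag-n12-w6's displayed `hcurv` VERBATIM.
Proof: `B15Prop1SliceDatumCurvatureUniformB.exists_uniform_sliceDatum_curvatureLetter` on the CLOSED (hence compact, `SU(2)^{bonds}` is compact) set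
`T = {U | every plaquette of the tower box of every positive-level constrained bond of 𝐁_k(Z) is ≤ ρ″∕(2(d−1)(6Lʲ−4))-small}`: it contains the class ([15] (2) one level down on the box,
`boxPlaqs_subset_plaqsOf_topSeq_pred`, and the floor), and on it every configuration is (0.4)-guarded along every tower (`N12TowerGuardsOfClass.guardOn_towerRegion_of_plaqSmallOn_towerBox` at
tolerance `ρ″∕((d−1)(6Lʲ−4))`).  LOCATED: `M₂` is an EXISTENCE constant per (instance, height) (U4 grade) — print's volume-uniform `O(1)` of [15] (46) is NOT claimed.
[cite: Balaban1985Variational, (2) p.278, Sect. C (44)–(48) p.285, (81)–(83) p.290, Prop. 9 (190) p.309; Balaban1989LargeFieldII, (1.12)–(1.13) p.359; Balaban1988Convergent, (2.2) p.255, (2.10)–(2.13) pp.256–257; Balaban1987RG1, (0.4) p.253] -/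
theorem exists_uniform_sliceDatum_curvatureLetter_of_class (ν : Stage7Numerics) (Kt : ℕ) (hd : 2 ≤ (F.P Kt).d) {k : ℕ} (Z : Set (Site (F.P Kt) 0))
    (hkK : k + 1 ≤ (F.P Kt).m + (F.P Kt).K) (hM4 : 4 * (F.P Kt).L ≤ ν.M₁) (hdiv : side (F.P Kt).L ν.M₁ k ∣ (F.P Kt).sitesPerDir 0) (hε : 0 ≤ ν.εreg)
    {ρ'' : ℝ} (hρ : 0 < ρ'') (hsbU : ∀ V : GaugeField (F.P Kt) 0 SU2, ‖coeField V - 1‖ ≤ ρ'' → SmallBelow (avOfRecord F 2 Kt) k V)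
    (hερ : 12 * ((((F.P Kt).d - 1 : ℕ)) : ℝ) * (F.P Kt).L * ν.εreg ≤ ρ'') :
    ∃ M₂ : ℝ, 0 ≤ M₂ ∧ ∀ U₀ ∈ regMSCoPOfRecord F 2 ν Kt k (maxDomT ν.M₁ Z), ∀ W : MSField (F.P Kt) SU2,
      AgreeOnB (lamBondsSeq (maxDomT ν.M₁ Z) k) (avgFamily (avOfRecord F 2 Kt) U₀) W →
      ∀ (S : Submodule ℂ (VecField (F.P Kt) 0 (EuclideanSpace ℂ (Fin 3)))) (Φ₀ : S → Fin (constrCardB (lamBondsSeq (maxDomT ν.M₁ Z) k) k) → EuclideanSpace ℂ (Fin 3)),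
        (∀ (X : S) i, Φ₀ X i = logCoordC (star ((W ((constrEnumB (lamBondsSeq (maxDomT ν.M₁ Z) k) k).symm i).1 ((constrEnumB (lamBondsSeq (maxDomT ν.M₁ Z) k) k).symm i).2.1 : SU2) : Matrix (Fin 2) (Fin 2) ℂ) *
          iterMh ((constrEnumB (lamBondsSeq (maxDomT ν.M₁ Z) k) k).symm i).1 (expMulC (X : VecField (F.P Kt) 0 (EuclideanSpace ℂ (Fin 3))) (coeField U₀)) ((constrEnumB (lamBondsSeq (maxDomT ν.M₁ Z) k) k).symm i).2.1)) →
        ∀ (p : VecField (F.P Kt) 0 E3) (hp : cplxVec p ∈ S), fderiv ℂ Φ₀ 0 ⟨cplxVec p, hp⟩ = 0 →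
          ‖fderiv ℂ (fderiv ℂ Φ₀) 0 ⟨cplxVec p, hp⟩ ⟨cplxVec p, hp⟩‖ ≤ M₂ * ∑ b : PBond (F.P Kt) 0, ‖p b‖ ^ 2 := by
  have hk : k ≤ (F.P Kt).m + (F.P Kt).K := by omega
  have hM1 : 1 ≤ ν.M₁ := le_trans (by have := three_le_L (F.P Kt); omega) hM4
  have hd1 : (0 : ℝ) < ((((F.P Kt).d - 1 : ℕ)) : ℝ) := by
    have : 1 ≤ (F.P Kt).d - 1 := by omega
    exact_mod_cast this
  have hL1 : 1 ≤ (F.P Kt).L := (F.P Kt).L_pos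
  -- notation: the constrained bonds of `𝐁_k(Z)`, the tower boxes and the closed tolerance
  set 𝔅 : BDetSet (F.P Kt) := lamBondsSeq (maxDomT ν.M₁ Z) k with h𝔅
  set J : Fin (constrCardB 𝔅 k) → ℕ := fun i => (((constrEnumB 𝔅 k).symm i).1 : ℕ) with hJ
  set lo : Fin (constrCardB 𝔅 k) → Fin (F.P Kt).d → ℤ := fun i κ =>
    (((embIter (J i) ((constrEnumB 𝔅 k).symm i).2.1.src) κ).val : ℤ) - ((3 * (F.P Kt).L ^ (J i) - 3 : ℕ) : ℤ) with hlo
  set hi : Fin (constrCardB 𝔅 k) → Fin (F.P Kt).d → ℤ := fun i κ =>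
    (((embIter (J i) ((constrEnumB 𝔅 k).symm i).2.1.src) κ).val : ℤ) + ((3 * (F.P Kt).L ^ (J i) - 3 : ℕ) : ℤ) + 2 with hhi
  set B : ℕ → ℝ := fun j => ρ'' / (2 * ((((F.P Kt).d - 1 : ℕ)) : ℝ) * ((6 * (F.P Kt).L ^ j - 4 : ℕ) : ℕ)) with hB
  have hside : ∀ j, (0 : ℝ) < ((6 * (F.P Kt).L ^ j - 4 : ℕ) : ℕ) := fun j => by
    have hq : 1 ≤ (F.P Kt).L ^ j := Nat.one_le_pow _ _ hL1
    have : 2 ≤ 6 * (F.P Kt).L ^ j - 4 := by omega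
    exact_mod_cast (by omega : 0 < 6 * (F.P Kt).L ^ j - 4)
  have hBpos : ∀ j, 0 < B j := fun j => by
    simp only [hB]
    exact div_pos hρ (by have := hside j; positivity)
  -- the closed plaquette-small set
  set T : Set (GaugeField (F.P Kt) 0 SU2) := {U | ∀ i : Fin (constrCardB 𝔅 k), 1 ≤ J i →
    ∀ q ∈ (boxPlaqs (lo i) (hi i) : Set (Plaq (F.P Kt) 0)), dist1 (GaugeField.plaqHol U q) ≤ B (J i)} with hT
  have hTclosed : IsClosed T := by
    have hrepr : T = ⋂ i : Fin (constrCardB 𝔅 k), ⋂ (_ : 1 ≤ J i), ⋂ q ∈ (boxPlaqs (lo i) (hi i) : Set (Plaq (F.P Kt) 0)),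
        {U : GaugeField (F.P Kt) 0 SU2 | dist1 (GaugeField.plaqHol U q) ≤ B (J i)} := by
      ext U
      simp only [hT, Set.mem_setOf_eq, Set.mem_iInter]
    rw [hrepr]
    exact isClosed_iInter fun i => isClosed_iInter fun _ => isClosed_biInter fun q _ =>
      isClosed_le (continuous_dist1_plaqHol q) continuous_const
  haveI : CompactSpace (GaugeField (F.P Kt) 0 SU2) := inferInstanceAs (CompactSpace (PBond (F.P Kt) 0 → SU2))
  have hTcomp : IsCompact T := hTclosed.isCompact
  -- every configuration of `T` is guarded along every tower
  have hgT : ∀ U ∈ T, ∀ i : Fin (constrCardB 𝔅 k), ∀ j', j' < (((constrEnumB 𝔅 k).symm i).1 : ℕ) → ∀ c' : PBond (F.P Kt) (j' + 1),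
      c' ∈ bondsIn (j' + 1) (blockIter (((constrEnumB 𝔅 k).symm i).1 : ℕ) ⁻¹'
        ({((constrEnumB 𝔅 k).symm i).2.1.src, ((constrEnumB 𝔅 k).symm i).2.1.tgt} : Set (Site (F.P Kt) ((constrEnumB 𝔅 k).symm i).1))) →
        Small expMeanLogSU (Averaging.iter (fun j => blockAvg (P := F.P Kt) (j := j) expMeanLogSU) j' U) c' := by
    intro U hU i
    rcases Nat.eq_zero_or_pos (J i) with h0 | hpos
    · intro j' hj'
      exact absurd hj' (by simp only [hJ] at h0; omega)
    · have hj1 : 1 ≤ J i := hpos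
      have hjk : J i ≤ k := Nat.lt_succ_iff.1 ((constrEnumB 𝔅 k).symm i).1.2
      have hsmall : PlaqSmallOn (boxPlaqs (lo i) (hi i) : Set (Plaq (F.P Kt) 0)) (2 * B (J i)) U := fun q hq =>
        lt_of_le_of_lt (hU i hj1 q hq) (by have := hBpos (J i); linarith)
      have hbudget : ((((F.P Kt).d - 1 : ℕ)) : ℝ) * ((6 * (F.P Kt).L ^ (J i) - 4 : ℕ) : ℕ) * (2 * B (J i)) ≤ ρ'' := by
        refine le_of_eq ?_
        simp only [hB]
        have h1 := hside (J i)
        field_simp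
      exact guardOn_towerRegion_of_plaqSmallOn_towerBox (F := F) (N := 2) Kt hkK hj1 hjk ((constrEnumB 𝔅 k).symm i).2.1 subset_rfl
        (by have := hBpos (J i); positivity) hsmall hsbU hbudget
  -- one constant for the compact guarded family
  obtain ⟨M₂, hM₂, hR2⟩ := exists_uniform_sliceDatum_curvatureLetter 𝔅 k hk hTcomp hgT
  refine ⟨M₂, hM₂, fun U₀ hU₀ W hW S Φ₀ hΦ₀ p hp hker => hR2 U₀ ?_ W hW S Φ₀ hΦ₀ p hp hker⟩
  -- the class lies in `T`: [15] (2) one level down on the tower box, and the floor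
  intro i hj1 q hq
  have hjk : J i ≤ k := Nat.lt_succ_iff.1 ((constrEnumB 𝔅 k).symm i).1.2
  set c := ((constrEnumB 𝔅 k).symm i).2.1 with hc
  have hcmem : c ∈ bondsOf (Bj ν.M₁ Z k (J i)) := lamBondsSeq_subset_bondsOf_genSet _ _ _ ((constrEnumB 𝔅 k).symm i).2.2
  -- the end of `c` in `Γ_j ⊆ Ω_j^{(j)}` and the straight word to `c₋`
  obtain ⟨y, hy, hyΩ⟩ : ∃ y : Site (F.P Kt) (J i), (y = c.src ∨ y = c.tgt) ∧ embIter (J i) y ∈ maxDomT ν.M₁ Z (J i) := by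
    have hsub : Bj ν.M₁ Z k (J i) ⊆ pts (J i) (maxDomT ν.M₁ Z (J i)) := by
      rcases lt_or_eq_of_le hjk with hlt | heq
      · rw [Bj_mid hj1 hlt]; exact fun _ h => h.1
      · rw [heq, Bj_top]
    rcases hcmem with h | h
    · exact ⟨c.src, Or.inl rfl, mem_pts.1 (hsub h)⟩
    · exact ⟨c.tgt, Or.inr rfl, mem_pts.1 (hsub h)⟩
  obtain ⟨w₀, hw₀len, hw₀⟩ := exists_word_endpoints c hy (Or.inl rfl : c.src = c.src ∨ c.src = c.tgt)
  have hfitR : (F.P Kt).L ^ (J i) + (3 * (F.P Kt).L ^ (J i) - 3) + 3 ≤ (F.P Kt).L ^ (J i - 1) * ν.M₁ := by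
    obtain ⟨i', hi'⟩ : ∃ i', J i = i' + 1 := ⟨J i - 1, by omega⟩
    rw [hi', Nat.add_sub_cancel]
    have h4A : 4 * (F.P Kt).L ^ (i' + 1) ≤ (F.P Kt).L ^ i' * ν.M₁ :=
      calc 4 * (F.P Kt).L ^ (i' + 1) = (F.P Kt).L ^ i' * (4 * (F.P Kt).L) := by ring
        _ ≤ (F.P Kt).L ^ i' * ν.M₁ := Nat.mul_le_mul_left _ hM4
    have hq : 1 ≤ (F.P Kt).L ^ (i' + 1) := Nat.one_le_pow _ _ hL1
    omega
  have hplaqs : (boxPlaqs (lo i) (hi i) : Set (Plaq (F.P Kt) 0)) ⊆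
      B8Eq17ClassAkV1.plaqsOf (topSeq (suppDomOfRecord F ν Kt (maxDomT ν.M₁ Z)) (maxDomT ν.M₁ Z) (J i - 1)) :=
    boxPlaqs_subset_plaqsOf_topSeq_pred ν Kt hj1 hjk hM1 hdiv Z hyΩ hw₀ hw₀len hfitR
  have hcls : PlaqSmallOn (B8Eq17ClassAkV1.plaqsOf (topSeq (suppDomOfRecord F ν Kt (maxDomT ν.M₁ Z)) (maxDomT ν.M₁ Z) (J i - 1)))
      (ν.εreg * (F.P Kt).eta (J i - 1) ^ 2) U₀ := hU₀.1 (J i - 1) (by omega)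
  have hlt := hcls q (hplaqs hq)
  refine hlt.le.trans ?_
  -- the floor: `εreg·η_{j−1}² ≤ ρ″∕(2(d−1)(6Lʲ−4))`
  have hside' := boxSide_mul_eta_sq_le (F.P Kt) hj1
  have hs := hside (J i)
  simp only [hB]
  rw [le_div_iff₀ (by positivity)]
  have hcast : (((6 * (F.P Kt).L ^ (J i) - 4 : ℕ) : ℕ) : ℝ) = ((6 * (F.P Kt).L ^ (J i) - 4 : ℕ) : ℝ) := rfl
  calc ν.εreg * (F.P Kt).eta (J i - 1) ^ 2 * (2 * ((((F.P Kt).d - 1 : ℕ)) : ℝ) * ((6 * (F.P Kt).L ^ (J i) - 4 : ℕ) : ℕ))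
      = 2 * ((((F.P Kt).d - 1 : ℕ)) : ℝ) * ((((6 * (F.P Kt).L ^ (J i) - 4 : ℕ) : ℝ) * (F.P Kt).eta (J i - 1) ^ 2) * ν.εreg) := by rw [hcast]; ring
    _ ≤ 2 * ((((F.P Kt).d - 1 : ℕ)) : ℝ) * ((6 * ((F.P Kt).L : ℝ)) * ν.εreg) := by gcongr
    _ = 12 * ((((F.P Kt).d - 1 : ℕ)) : ℝ) * (F.P Kt).L * ν.εreg := by ring
    _ ≤ ρ'' := hερ

end

end Summit.QuantumFields.YangMills.BalabanUVNodes.N12SliceDatumCurvatureOfClassB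

end
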